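import Summits.AtomisticToContinuum.Crystallization.Theorems.FrustratedLawDichotomyStrainedPatchHomEntryFitHcp

/-!
# The SHARP hcp (P1) fit prune, part 1 (kit): per-neighbour Cartesian enclosures and the verdict `fitOKHS`

decomp-a2c hand-2 g23 (crux `AperiodicFrustratedLawGap`, stmt-AtomisticToContinuum-27623; sequel of hand-2 g22 `…HomEntryFitHcpKit` /
`…HomEntryFitHcp`, the hcp analogue of g22's fcc sharpenings `fitOK2` / `fitOK3`; soundness and the (H) theorems are in `…HomEntryFitHcpSharp`).

MEASURED (this session, farm `#eval`, thin boxes of half-width `2⁻¹³` on the basal-shear path `U = 0.97·(1 + e(E₁₂ + E₂₁))`, `ξ = 0`): the v1 hcp fit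
verdict `fitOKH` fires at `e = 0.015` and fails from `e = 0.018`, while the hcp (P4) floor verdict at `1/625` (`entryLeafOKHc muRec`) is false up to
`e = 0.022` and true from `e = 0.026` — with v1 the window `0.018 ≤ e ≤ 0.022` is decided by NO verdict, so the hcp search cannot terminate there.  Cause: the
misfit bound `6ρ² + 12λ²‖ξ‖²` (`ρ = max_k ‖V q_k‖`, all pairs, Cauchy) carries a factor ≈ 3–6 over the true squared misfit, and a shuffle `‖ξ‖ = 0.01` alone
costs `12λ²‖ξ‖² ≈ 1.1·10⁻³` of the budget `(0.049 d)² ≈ 2.3·10⁻³` although the true contribution of the shuffle to the misfit of a `B`-neighbour is `U ξ`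
exactly and of an `A`-neighbour is `0`.  The sharp verdict below fires up to `e = 0.024` on the same path (and at `e = 0.02` with `ξ = (0.01,0,0)`).

THE SHARPENING (same real fit theorem `…HomEntryFitHcpKit.goodAtScale_of_fitBounds_hcp`, all pairs `k, k'`; only the ENCLOSURE changes).  With
`λ = scaleL`, `V = U − λ·1`, `n_k = nbr k` (unit), the deformed neighbour is `nbrU k = λ n_k + R_k`, `R_k = V n_k + s_k U ξ` (`s_k` the sublattice flag), so
EXACTLY `‖nbrU k'‖² = λ² + 2λ⟪R_{k'}, n_{k'}⟫ + ‖R_{k'}‖²` and, with `δ = ‖nbrU k'‖ − λ`,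
`‖nbrU k − ‖nbrU k'‖·n_k‖² = ‖R_k − δ n_k‖² = ‖R_k‖² − 2δ⟪R_k, n_k⟫ + δ²`.
The kernel evaluates the three Cartesian components of `R_k` from the deviation entries and the shuffle box (`…HomEntryGramHcp.uF/uT`), then `⟪R_k,n_k⟫`,
`‖R_k‖²` (`dot3`), `‖nbrU k‖²`, `δ` (`FI.sqrt`) and the pair misfit — every quantity at the intrinsic (small) scale, no Cauchy step, the shuffle exact.

* §1 the component enclosures (`hexFI`, `shiftFI`, `nbrFI` of `n_k`; `rVec` of `R_k`) and their `mem` lemmas; the decomposition `nbrU k = λ n_k + R_k`;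
* §2 the kernel data `rP`, `rSq`, `nrm2`, `dlt`, `mis`, `misMax`, `d2S` and ★ `fitOKHS` (= `fitOKH` with the misfit conjunct replaced by the sharp pair
  test `10⁶ · misMax ≤ 2401 · d2S` and `d2lo` by `min_k nrm2.lo`).

All definitions computable; 0 sorry; standard axioms; no instances / notation / `#eval`.  `--supports stmt-AtomisticToContinuum-27623`.
-/

namespace Summit.AtomisticToContinuum.Crystallization.Theorems.FrustratedLawDichotomyStrainedPatchHomEntryFitHcpSharpKit

open scoped BigOperators RealInnerProductSpace
open Literature.Analysis.ValidatedNumerics.Numerics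
open Summit.AtomisticToContinuum.Crystallization.Theorems.ChargedEnergyGapNegative (E3)
open Summit.AtomisticToContinuum.Crystallization.Theorems.FrustratedLawDichotomySchurCut (effPot w₄₅ ω₄)
open Summit.AtomisticToContinuum.Crystallization.Theorems.FrustratedLawDichotomyMotifLemmas (GoodAtScale)
open Summit.AtomisticToContinuum.Crystallization.Theorems.FrustratedLawDichotomyAveragingRuleTightFree (TightNearCap BadNearCap)
open Summit.AtomisticToContinuum.Crystallization.Theorems.FrustratedLawDichotomyExemptAbsorption (ExemptNear)
open Summit.AtomisticToContinuum.Crystallization.Theorems.FrustratedLawDichotomyStrainedPatchHomSplit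
open Summit.AtomisticToContinuum.Crystallization.Theorems.FrustratedLawDichotomyStrainedPatchHomLatticeBoxHcp (latPt_eq_apply_one)
open Summit.AtomisticToContinuum.Crystallization.Theorems.FrustratedLawDichotomyAveragingCut (self_mem_ball)
open Summit.AtomisticToContinuum.Crystallization.Theorems.FrustratedLawDichotomyStrainedPatchHomPrunes (locHom_hcp_centre)
open Summit.AtomisticToContinuum.Crystallization.Theorems.FrustratedLawDichotomyStrainedPatchHomPrunedPolar (homFloor_of_prunedBoxSums_selfAdjoint)
open Summit.AtomisticToContinuum.Crystallization.Theorems.FrustratedLawDichotomyStrainedPatchHomCertTree (CertTree treeOK)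
open Summit.AtomisticToContinuum.Crystallization.Theorems.FrustratedLawDichotomyStrainedPatchHomEntryGram
open Summit.AtomisticToContinuum.Crystallization.Theorems.FrustratedLawDichotomyStrainedPatchHomEntryFitKit (lmin lmin_le_of_mem lmin_mem)
open Summit.AtomisticToContinuum.Crystallization.Theorems.FrustratedLawDichotomyStrainedPatchHomEntryFit (scaleL devFI lmax le_lmax_of_mem)
open Summit.AtomisticToContinuum.Crystallization.Theorems.FrustratedLawDichotomyStrainedPatchHomEntryGramHcp
open Summit.AtomisticToContinuum.Crystallization.Theorems.FrustratedLawDichotomyStrainedPatchHomEntryHcpFrame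
open Summit.AtomisticToContinuum.Crystallization.Theorems.FrustratedLawDichotomyStrainedPatchHomEntryFitHcpKit
open Summit.AtomisticToContinuum.Crystallization.Theorems.FrustratedLawDichotomyStrainedPatchHomEntryFitHcp

/-! ## §1. Cartesian component enclosures of `n_k` and `R_k` -/

/-- Coordinate `a` of a vector of `E3` as an inner product with the basis vector. [formal bookkeeping] -/
theorem apply_eq_inner_single (w : E3) (a : Fin 3) : w a = ⟪EuclideanSpace.single a (1 : ℝ), w⟫ := by
  rw [EuclideanSpace.inner_single_left]; simp

/-- Enclosure of the components of the hexagonal frame vectors `hexFrame i`. -/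
def hexFI (i a : Fin 3) : FI :=
  if i = 0 then (if a = 0 then FI.ofInt 1 else FI.ofInt 0)
  else if i = 1 then (if a = 0 then FI.ofFrac 1 2 else if a = 1 then s3.divNat 2 else FI.ofInt 0)
  else (if a = 2 then s83 else FI.ofInt 0)

/-- Enclosure of the components of `hcpShift = (1/2, √3/6, √(2/3))`. -/
def shiftFI (a : Fin 3) : FI := if a = 0 then FI.ofFrac 1 2 else if a = 1 then s3.divNat 6 else s23

/-- `hexFI` encloses the frame components. [formal bookkeeping] -/
theorem mem_hexFI (i a : Fin 3) : FI.mem (hexFrame i a) (hexFI i a) := by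
  have h0 : FI.mem (0 : ℝ) (FI.ofInt 0) := by simpa using FI.mem_ofInt 0
  have h1 : FI.mem (1 : ℝ) (FI.ofInt 1) := by simpa using FI.mem_ofInt 1
  have hs32 : FI.mem (Real.sqrt 3 / 2) (s3.divNat 2) := by simpa using FI.mem_divNat mem_s3 (n := 2) (by norm_num)
  match i with
  | 0 =>
    rw [hexFI, if_pos rfl, hexFrame_apply₀]
    fin_cases a
    · simpa using h1
    · simpa using h0
    · simpa using h0
  | 1 =>
    rw [hexFI, if_neg (by decide), if_pos rfl, hexFrame_apply₁]
    fin_cases a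
    · simpa using mem_half
    · simpa using hs32
    · simpa using h0
  | 2 =>
    rw [hexFI, if_neg (by decide), if_neg (by decide), hexFrame_apply₂]
    fin_cases a
    · simpa using h0
    · simpa using h0
    · simpa using mem_s83

/-- `shiftFI` encloses the components of `hcpShift`. [formal bookkeeping] -/
theorem mem_shiftFI (a : Fin 3) : FI.mem (hcpShift a) (shiftFI a) := by
  have hs36 : FI.mem (Real.sqrt 3 / 6) (s3.divNat 6) := by simpa using FI.mem_divNat mem_s3 (n := 6) (by norm_num)
  unfold shiftFI
  rw [hcpShift_apply]
  fin_cases a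
  · simpa using mem_half
  · simpa using hs36
  · simpa using mem_s23

/-- Enclosure of the components of the unit neighbour `n_k = nbr k = Σᵢ hlab k i • hexFrame i (+ hcpShift)`. -/
def nbrFI (k : Fin 12) (a : Fin 3) : FI :=
  ((((hexFI 0 a).mulInt (hlab k 0)).add ((hexFI 1 a).mulInt (hlab k 1))).add ((hexFI 2 a).mulInt (hlab k 2))).add
    (if hshift k then shiftFI a else FI.ofInt 0)

/-- `nbrFI` encloses the components of `nbr k`. [formal bookkeeping] -/
theorem mem_nbrFI (k : Fin 12) (a : Fin 3) : FI.mem ((nbr k) a) (nbrFI k a) := by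
  have e : (nbr k) a = (hexFrame 0 a * ((hlab k 0 : ℤ) : ℝ) + hexFrame 1 a * ((hlab k 1 : ℤ) : ℝ) + hexFrame 2 a * ((hlab k 2 : ℤ) : ℝ)) +
      (if hshift k then hcpShift else 0) a := by
    unfold nbr
    rw [apply_eq_inner_single, inner_add_right, inner_sum, Fin.sum_univ_three, inner_smul_right, inner_smul_right, inner_smul_right,
      ← apply_eq_inner_single, ← apply_eq_inner_single, ← apply_eq_inner_single, ← apply_eq_inner_single]
    ring
  rw [e]
  refine FI.mem_add (FI.mem_add (FI.mem_add (FI.mem_mulInt (mem_hexFI 0 a) _) (FI.mem_mulInt (mem_hexFI 1 a) _)) (FI.mem_mulInt (mem_hexFI 2 a) _)) ?_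
  cases hshift k
  · simpa using FI.mem_ofInt 0
  · simpa using mem_shiftFI a

/-- Enclosure of the components of `R_k = V n_k + s_k U ξ = latPt V hexFrame (hlab k) + s_k (V (hcpShift + ξ) + λ ξ)` from the deviation entries `E'`
(of `V`), the shuffle box `X` and the scale `Lm ∋ λ`. -/
def rVec (E' : Fin 3 × Fin 3 → FI) (X : Fin 3 → FI) (Lm : FI) (k : Fin 12) (a : Fin 3) : FI :=
  ((((uF E' 0 a).mulInt (hlab k 0)).add ((uF E' 1 a).mulInt (hlab k 1))).add ((uF E' 2 a).mulInt (hlab k 2))).add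
    (if hshift k then (uT E' X a).add (Lm.mul (X a)) else FI.ofInt 0)

/-- The real vector `R_k` (as a function of `V`, `ξ`, `λ`). -/
noncomputable def rReal (V : E3 →L[ℝ] E3) (ξ : E3) (lam : ℝ) (k : Fin 12) : E3 :=
  latPt V hexFrame (hlab k) + if hshift k then V (hcpShift + ξ) + lam • ξ else 0

/-- `rVec` encloses the components of `R_k`. [formal bookkeeping] -/
theorem mem_rVec (V : E3 →L[ℝ] E3) (ξ : E3) {lam : ℝ} {E' : Fin 3 × Fin 3 → FI} {X : Fin 3 → FI} {Lm : FI}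
    (hE' : ∀ ab : Fin 3 × Fin 3, FI.mem ((V (EuclideanSpace.single ab.2 (1 : ℝ))) ab.1) (E' ab)) (hX : ∀ i, FI.mem (ξ i) (X i))
    (hL : FI.mem lam Lm) (k : Fin 12) (a : Fin 3) : FI.mem ((rReal V ξ lam k) a) (rVec E' X Lm k a) := by
  have e : (rReal V ξ lam k) a = ((V (hexFrame 0)) a * ((hlab k 0 : ℤ) : ℝ) + (V (hexFrame 1)) a * ((hlab k 1 : ℤ) : ℝ) +
      (V (hexFrame 2)) a * ((hlab k 2 : ℤ) : ℝ)) + (if hshift k then V (hcpShift + ξ) + lam • ξ else 0) a := by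
    unfold rReal latPt
    rw [map_sum, apply_eq_inner_single, inner_add_right, inner_sum, Fin.sum_univ_three, map_smul, map_smul, map_smul,
      inner_smul_right, inner_smul_right, inner_smul_right, ← apply_eq_inner_single, ← apply_eq_inner_single, ← apply_eq_inner_single,
      ← apply_eq_inner_single]
    ring
  rw [e]
  refine FI.mem_add (FI.mem_add (FI.mem_add (FI.mem_mulInt (mem_uF V hE' 0 a) _) (FI.mem_mulInt (mem_uF V hE' 1 a) _))
    (FI.mem_mulInt (mem_uF V hE' 2 a) _)) ?_
  cases hshift k
  · simpa using FI.mem_ofInt 0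
  · simp only [↓reduceIte, PiLp.add_apply, PiLp.smul_apply, smul_eq_mul]
    exact FI.mem_add (mem_uT V ξ hE' hX a) (FI.mem_mul hL (hX a))

/-- ★ The decomposition `nbrU k = λ • n_k + R_k` (`U = λ·1 + V`). [folklore] -/
theorem nbrU_eq_smul_add_rReal {U V : E3 →L[ℝ] E3} {lam : ℝ} (hV : ∀ x : E3, U x = lam • x + V x) (ξ : E3) (k : Fin 12) :
    nbrU U ξ k = lam • nbr k + rReal V ξ lam k := by
  have e1 : latPt U hexFrame (hlab k) = lam • latPt 1 hexFrame (hlab k) + latPt V hexFrame (hlab k) := by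
    rw [latPt_eq_apply_one U, hV, latPt_eq_apply_one V]
  unfold nbrU nbr rReal
  rw [show latPt 1 hexFrame (hlab k) = ∑ i : Fin 3, ((hlab k i : ℤ) : ℝ) • hexFrame i by simp [latPt]] at e1
  cases hshift k
  · simp only [Bool.false_eq_true, ↓reduceIte, add_zero]; rw [e1]
  · simp only [↓reduceIte, smul_add]; rw [e1, hV (hcpShift + ξ), smul_add]; abel

/-! ## §2. The sharp kernel data and the verdict -/

/-- `⟪R_k, n_k⟫` in the kernel. -/
def rP (E' : Fin 3 × Fin 3 → FI) (X : Fin 3 → FI) (Lm : FI) (k : Fin 12) : FI := dot3 (rVec E' X Lm k) (nbrFI k)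

/-- `‖R_k‖²` in the kernel. -/
def rSq (E' : Fin 3 × Fin 3 → FI) (X : Fin 3 → FI) (Lm : FI) (k : Fin 12) : FI := dot3 (rVec E' X Lm k) (rVec E' X Lm k)

/-- `‖nbrU k‖² = λ² + 2λ⟪R_k, n_k⟫ + ‖R_k‖²` in the kernel (cancellation-free in the small data). -/
def nrm2 (E' : Fin 3 × Fin 3 → FI) (X : Fin 3 → FI) (Lm : FI) (k : Fin 12) : FI :=
  ((Lm.sqr).add (((Lm.mul (rP E' X Lm k))).mulInt 2)).add (rSq E' X Lm k)

/-- `δ_{k'} = ‖nbrU k'‖ − λ` in the kernel. -/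
def dlt (E' : Fin 3 × Fin 3 → FI) (X : Fin 3 → FI) (Lm : FI) (k : Fin 12) : FI := (FI.sqrt (nrm2 E' X Lm k)).sub Lm

/-- The pair misfit `‖R_k‖² − 2δ_{k'}⟪R_k, n_k⟫ + δ_{k'}² = ‖nbrU k − ‖nbrU k'‖·n_k‖²` in the kernel. -/
def mis (E' : Fin 3 × Fin 3 → FI) (X : Fin 3 → FI) (Lm : FI) (k k' : Fin 12) : FI :=
  ((rSq E' X Lm k).sub ((((dlt E' X Lm k').mul (rP E' X Lm k))).mulInt 2)).add ((dlt E' X Lm k').sqr)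

/-- Deviation entries of the entry/shuffle box at scale `L`. -/
def devH (c w : (Fin 3 × Fin 3) ⊕ Fin 3 → ℤ) (L : ℤ) : Fin 3 × Fin 3 → FI :=
  devFI (fun ab => c (Sum.inl ab)) (fun ab => w (Sum.inl ab)) L

/-- The largest upper end of the pair misfits (scaled). -/
def misMax (c w : (Fin 3 × Fin 3) ⊕ Fin 3 → ℤ) (L : ℤ) : ℤ :=
  lmax (K12H.flatMap fun k => K12H.map fun k' => (mis (devH c w L) (shufFI c w) (FI.ofScaled L) k k').hi)

/-- The sharp `d²` lower end: `min_k nrm2.lo` (scaled). -/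
def d2S (c w : (Fin 3 × Fin 3) ⊕ Fin 3 → ℤ) (L : ℤ) : ℤ := lmin (K12H.map fun k => (nrm2 (devH c w L) (shufFI c w) (FI.ofScaled L) k).lo)

/-- ★ **THE SHARP hcp (P1) FIT VERDICT on an entry/shuffle box**: `fitOKH`'s conjuncts with the misfit test replaced by the sharp pair test
`10⁶ · misMax ≤ 2401 · d2S` (misfit `≤ (49/1000)² d²`). -/
def fitOKHS (c w : (Fin 3 × Fin 3) ⊕ Fin 3 → ℤ) : Bool :=
  let L := scaleL (fun ab => c (Sum.inl ab))
  let D := dEnclH c w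
  decide (0 ≤ L) && decide (0 < D.lo) && decide (D.lo ≤ D.hi) && decide (2 * D.hi ≤ 3 * (SC : ℤ)) &&
  decide ((SC : ℤ) ≤ 130 * D.lo) && decide (4 * (xiSq c w).hi ≤ (SC : ℤ)) &&
  decide (1000000 * misMax c w L ≤ 2401 * d2S c w L) &&
  K12H.all (fun k => decide ((nbrSq c w k).hi * SC * 10000 ≤ (130 * D.lo - SC) ^ 2)) &&
  decide (∀ b ∈ box7all,
    (b = 0 ∨ (∃ k : Fin 12, hshift k = false ∧ hlab k = b) ∨ (130 * D.hi + (SC : ℤ)) ^ 2 ≤ (qform13 (extU c w) b false).lo * SC * 10000) ∧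
    ((∃ k : Fin 12, hshift k = true ∧ hlab k = b) ∨ (130 * D.hi + (SC : ℤ)) ^ 2 ≤ (qform13 (extU c w) b true).lo * SC * 10000))

end Summit.AtomisticToContinuum.Crystallization.Theorems.FrustratedLawDichotomyStrainedPatchHomEntryFitHcpSharpKit
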